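import Literature.Analysis.FluidPDE.CheskidovLimitDrift
import Literature.Analysis.FluidPDE.CheskidovAssemblyTools
import Literature.Analysis.FunctionSpaces.TorusWeakNull
import HarnessLib

/-!
# Cheskidov's time-glued family: the estimates behind the no-anomaly family
(arXiv:2311.04182, §3 (3.6), (3.10)–(3.13), Lemma 3.2; Bruè–De Lellis 2023, Lemma 5.1)

Topic `Literature/Analysis/FluidPDE` (family `turb`; support file for the proof of
`Literature.Analysis.FluidPDE.cheskidov_noAnomaly_family`). Quantitative estimates for the landed
glued objects `Gluing.drift`, `Gluing.profile`, `Gluing.limProfile`, `Gluing.blockForce`,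
`Gluing.limForce` (`CheskidovGluedFamily`, `CheskidovForces`) and the limit drift
`Gluing.limDrift` (`CheskidovLimitDrift`), in terms of `Gluing.Blocks`, the scalar clauses of
Cheskidov 2023, Thm. 3.1 (b) (stated inline, as in `CheskidovGluedEstimates`), the velocity
bounds `Gluing.BlockDerivBounds v A` and the gluing constants `|σₙ'| ≤ Bσ/τₙ`,
`|σₙ''| ≤ Bσ'/τₙ²` (`1/τₙ = (n+1)(n+2)`):

* the limit drift: `‖ṽ‖ ≤ 2BσA`, `∫‖ṽ(t)‖² → 0` as `t → 1⁻` ((3.10));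
* the block force `blockForce v n` (`= ∂ₜV + (V·∇)V` of the moving block): the sup bound
  `P²5⁻ⁿA₁` and the interpolated `C^{0,r}` bound `M + (√d d L)^r (2M)^{1-r}`, `M = P²5⁻ⁿA₁`,
  `L = P²A₂`, `P = (n+1)(n+2)`, which tends to `0` along the blocks for every `r < 1`
  (`blockForce_bounds`, `tendsto_profileForceBound`: Bruè–De Lellis 2023, Lemma 5.1 in the form
  `poly(n) λₙ^{α-1} → 0`, via `CheskidovGluedCalculus`); hence `‖g‖ ≤ 8A₁`;
* the viscous term `‖νΔ(blockDrift v n (t))‖_{C^{0,r}} ≤ ν Bσ (m+1)(m+2) E 125ᵐ` for `n ≤ m`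
  ((3.13); crude but sufficient since `ν_m` is chosen afterwards);
* dissipation integrands: `gradNormSq (v^m(t)) ≤ d (Bσ(m+1)(m+2)A)²` (Lemma 3.2, (3.16)) and
  `scalarGradNormSq (ρ^m(t)) ≤ (C5ᵐ)²` for every `t` ((3.6));
* the glued and limit profiles at every time: zero mean, unit `L²` norm, `|·| ≤ 10`,
  `‖ρ̃(t)‖_{Ḣ⁻¹} ≤ C5^{-blockIdx t}`, and the weak limit `ρ̃(t) ⇀ 0` in `L²` as `t → 1⁻` ((3.10)).

## References

* A. Cheskidov, arXiv:2311.04182 (2023), Thm. 3.1, (3.6), (3.10)–(3.13), Lemma 3.2 (3.16).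
* E. Bruè, C. De Lellis, Comm. Math. Phys. 400 (2023), Lemma 5.1.
-/

noncomputable section

open MeasureTheory Set Filter
open _root_.Topology
open scoped ENNReal NNReal ContDiff InnerProductSpace

namespace Literature.Analysis.FluidPDE.Gluing

open Literature.Analysis.FunctionSpaces

variable {d : Type*} [Fintype d] [DecidableEq d]

section Estimates

variable {ρ : ℕ → ℝ → UnitAddTorus d → ℝ} {v : ℕ → ℝ → UnitAddTorus d → EuclideanSpace ℝ d}
variable {A C Bσ Bσ' : ℝ} {m n : ℕ} {t : ℝ}

omit [Fintype d] [DecidableEq d] in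
/-- `B/τₙ = B (n+1)(n+2)`. [folklore] -/
theorem div_tau (B : ℝ) (n : ℕ) : B / tau n = B * ((n + 1) * (n + 2)) := by
  unfold tau; field_simp

omit [Fintype d] [DecidableEq d] in
/-- `((n+1)(n+2))² ≤ 8 · 5ⁿ`. [folklore] -/
theorem sq_succ_mul_succ_le_eight_mul_pow (n : ℕ) : (((n : ℝ) + 1) * (n + 2)) ^ 2 ≤ 8 * 5 ^ n := by
  induction n with
  | zero => norm_num
  | succ k ih =>
    rcases Nat.lt_or_ge k 1 with hk | hk
    · interval_cases k; norm_num
    · push_cast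
      have h5 : (5 : ℝ) ^ (k + 1) = 5 * 5 ^ k := by ring
      rw [h5]
      have hk' : (1 : ℝ) ≤ k := by exact_mod_cast hk
      nlinarith [ih, pow_pos (by norm_num : (0 : ℝ) < 5) k, hk']

omit [Fintype d] [DecidableEq d] in
/-- The gluing constant is nonnegative. [folklore] -/
theorem nonneg_of_abs_deriv_sigma_le (hBσ : ∀ n t, |deriv (sigma n) t| ≤ Bσ / tau n) : 0 ≤ Bσ := by
  have h := (abs_nonneg _).trans (hBσ 0 0)
  rw [div_tau] at h
  norm_num at h; linarith

omit [Fintype d] [DecidableEq d] in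
/-- The second gluing constant is nonnegative. [folklore] -/
theorem nonneg_of_abs_deriv_deriv_sigma_le (hBσ' : ∀ n t, |deriv (deriv (sigma n)) t| ≤ Bσ' / tau n ^ 2) :
    0 ≤ Bσ' := by
  have h := (abs_nonneg _).trans (hBσ' 0 0)
  exact (div_nonneg_iff.1 h).elim (fun h => h.1) fun h => by
    exfalso; exact not_lt.2 h.2 (pow_pos (tau_pos 0) 2)

/-! ### The limit drift: uniform bound and `L²` blow-up (Cheskidov 2023, (3.10)) -/

omit [DecidableEq d] in
/-- **Uniform bound on the limit drift**: `‖ṽ(t,x)‖ ≤ 2BσA` (Cheskidov 2023, Thm. 3.1 (a) with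
`α = k = 0` and the gluing factor `σₙ' ≲ n²`; cf. `norm_drift_le`). [cite: Cheskidov2023, §3 (3.7)] -/
theorem norm_limDrift_le (hA : BlockBounds v A) (hBσ : ∀ n t, |deriv (sigma n) t| ≤ Bσ / tau n)
    (t : ℝ) (x : UnitAddTorus d) : ‖limDrift v t x‖ ≤ 2 * Bσ * A := by
  have hB0 := nonneg_of_abs_deriv_sigma_le hBσ
  rcases lt_or_ge t 1 with h | h
  · obtain ⟨m, hm⟩ : ∃ m : ℕ, t < tn (m + 1) :=
      ((tendsto_tn.comp (tendsto_add_atTop_nat 1)).eventually (Ioi_mem_nhds h)).exists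
    rw [limDrift_eq_drift hm]
    exact norm_drift_le hA hB0 hBσ m t x
  · rw [limDrift_of_one_le h]; simp only [Pi.zero_apply, norm_zero]
    exact mul_nonneg (mul_nonneg zero_le_two hB0) hA.nonneg

omit [DecidableEq d] in
/-- Energy of the limit drift in the `n`-th gluing interval, `n = blockIdx t`:
`∫‖ṽ(t)‖² ≤ (Bσ A (n+1)(n+2) 5⁻ⁿ)²`. [cite: Cheskidov2023, §3 (3.10)] -/
theorem integral_norm_sq_limDrift_le (hA : BlockBounds v A) (hBσ : ∀ n t, |deriv (sigma n) t| ≤ Bσ / tau n)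
    (ht : t ∈ Ico (0 : ℝ) 1) :
    ∫ x, ‖limDrift v t x‖ ^ 2 ≤
      (Bσ * A * (((blockIdx t : ℝ) + 1) * (blockIdx t + 2)) * (5 ^ blockIdx t)⁻¹) ^ 2 := by
  have hmem := mem_Ico_tn_blockIdx ht.1 ht.2
  set n := blockIdx t
  have hpt : ∀ x, ‖limDrift v t x‖ ^ 2 ≤ (Bσ * A * (((n : ℝ) + 1) * (n + 2)) * (5 ^ n)⁻¹) ^ 2 := by
    intro x
    refine pow_le_pow_left₀ (norm_nonneg _) ?_ 2
    rw [limDrift_of_mem_Ico hmem]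
    refine (norm_blockDrift_le hA hBσ n t x).trans (le_of_eq ?_)
    rw [div_tau]; ring
  calc ∫ x, ‖limDrift v t x‖ ^ 2 ≤ ∫ _x : UnitAddTorus d, (Bσ * A * (((n : ℝ) + 1) * (n + 2)) * (5 ^ n)⁻¹) ^ 2 :=
        integral_mono_of_nonneg (ae_of_all _ fun x => by positivity) (integrable_const _) (ae_of_all _ hpt)
    _ = _ := by simp

omit [DecidableEq d] in
/-- **Blow-up of the limit drift in `L²`**: `∫‖ṽ(t)‖² → 0` as `t → 1⁻` (Cheskidov 2023, (3.10):
`lim_{t→1⁻}‖u(t)‖_{L²} = 1 = ‖ρ̃(t)‖_{L²}`, i.e. `‖ṽ(t)‖_{L²} → 0`). [cite: Cheskidov2023, §3 (3.10)] -/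
theorem tendsto_integral_norm_sq_limDrift (hA : BlockBounds v A)
    (hBσ : ∀ n t, |deriv (sigma n) t| ≤ Bσ / tau n) :
    Tendsto (fun t => ∫ x, ‖limDrift v t x‖ ^ 2) (𝓝[<] 1) (𝓝 0) := by
  set a : ℕ → ℝ := fun n => (Bσ * A * (((n : ℝ) + 1) * (n + 2)) * (5 ^ n)⁻¹) ^ 2 with ha
  have hlim : Tendsto a atTop (𝓝 0) := by
    have h1 : Tendsto (fun n : ℕ => ((n : ℝ) + 1) * (n + 2) * (5 ^ n)⁻¹) atTop (𝓝 0) := by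
      have hb : ∀ n : ℕ, ((n : ℝ) + 1) * (n + 2) * (5 ^ n)⁻¹ ≤ 6 * ((n : ℝ) ^ 2 * (5⁻¹ : ℝ) ^ n) + 2 * (5⁻¹ : ℝ) ^ n := by
        intro n
        have hn2 : (n : ℝ) ≤ (n : ℝ) ^ 2 := by
          have h := Nat.le_mul_self n
          have : (n : ℝ) ≤ (n : ℝ) * n := by exact_mod_cast h
          simpa [sq] using this
        have hpoly : ((n : ℝ) + 1) * (n + 2) ≤ 6 * (n : ℝ) ^ 2 + 2 := by nlinarith [n.cast_nonneg (α := ℝ)]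
        have hq : (0 : ℝ) ≤ (5 ^ n)⁻¹ := by positivity
        calc ((n : ℝ) + 1) * (n + 2) * (5 ^ n)⁻¹ ≤ (6 * (n : ℝ) ^ 2 + 2) * (5 ^ n)⁻¹ :=
              mul_le_mul_of_nonneg_right hpoly hq
          _ = _ := by rw [inv_pow]; ring
      have hl : Tendsto (fun n : ℕ => 6 * ((n : ℝ) ^ 2 * (5⁻¹ : ℝ) ^ n) + 2 * (5⁻¹ : ℝ) ^ n) atTop (𝓝 0) := by
        have t1 := tendsto_pow_const_mul_const_pow_of_lt_one 2 (by norm_num : (0 : ℝ) ≤ 5⁻¹) (by norm_num)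
        have t2 := tendsto_pow_atTop_nhds_zero_of_lt_one (by norm_num : (0 : ℝ) ≤ 5⁻¹) (by norm_num)
        simpa using (t1.const_mul 6).add (t2.const_mul 2)
      exact squeeze_zero (fun n => by positivity) hb hl
    have := (h1.const_mul (Bσ * A)).pow 2
    simpa [ha, mul_assoc] using this
  refine squeeze_zero' (Eventually.of_forall fun t => integral_nonneg fun x => by positivity) ?_
    (hlim.comp tendsto_blockIdx)
  filter_upwards [Ico_mem_nhdsLT (zero_lt_one' ℝ)] with t ht
  exact integral_norm_sq_limDrift_le hA hBσ ht


/-! ### The block force expression `c₂ V + c₁² ∂ₛV + c₁² (V·∇)V` and the Laplacian `ΔV` (generic) -/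

section BlockForce

variable [Nonempty d]
variable {V Vs : UnitAddTorus d → EuclideanSpace ℝ d} {c₁ c₂ β₁ β₂ K₀ K₁ K₂ K₃ K₀' K₁' : ℝ}

omit [Nonempty d] in
omit [DecidableEq d] in
/-- The block force expression is `C¹` (indeed smooth). [folklore] -/
theorem isContDiff_blockForceExpr (hV : Torus.IsSmooth V) (hVs : Torus.IsSmooth Vs) (c₁ c₂ : ℝ) :
    Torus.IsContDiff 1 (fun x => c₂ • V x + c₁ ^ 2 • Vs x + c₁ ^ 2 • Torus.convect V V x) :=
  (((hV.smul c₂).add (hVs.smul _)).add ((hV.convect hV).smul _)).isContDiff (by simp)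

/-- **Sup bound for the block force expression.** [folklore] -/
theorem norm_blockForceExpr_le (hV : Torus.IsSmooth V) (hc₁ : |c₁| ≤ β₁) (hc₂ : |c₂| ≤ β₂)
    (h0 : ∀ x, ‖V x‖ ≤ K₀) (h1 : ∀ x i, ‖Torus.partialDeriv i V x‖ ≤ K₁) (h0' : ∀ x, ‖Vs x‖ ≤ K₀')
    (x : UnitAddTorus d) :
    ‖c₂ • V x + c₁ ^ 2 • Vs x + c₁ ^ 2 • Torus.convect V V x‖ ≤
      β₂ * K₀ + β₁ ^ 2 * (K₀' + Fintype.card d * (K₀ * K₁)) := by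
  have hK₀ : 0 ≤ K₀ := (norm_nonneg _).trans (h0 x)
  have hK₁ : 0 ≤ K₁ := (norm_nonneg _).trans (h1 x (Classical.arbitrary d))
  have hK₀' : 0 ≤ K₀' := (norm_nonneg _).trans (h0' x)
  have hβ₂ : 0 ≤ β₂ := (abs_nonneg _).trans hc₂
  have hβ₁ : c₁ ^ 2 ≤ β₁ ^ 2 := by
    rw [← sq_abs c₁]; exact pow_le_pow_left₀ (abs_nonneg _) hc₁ 2
  have hconv : ‖Torus.convect V V x‖ ≤ Fintype.card d * (K₀ * K₁) :=
    (norm_convect_le (hV.isContDiff (by simp)) (h1 x)).trans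
      (mul_le_mul_of_nonneg_left (mul_le_mul_of_nonneg_right (h0 x) hK₁) (Nat.cast_nonneg _))
  calc _ ≤ ‖c₂ • V x‖ + ‖c₁ ^ 2 • Vs x‖ + ‖c₁ ^ 2 • Torus.convect V V x‖ := norm_add₃_le
    _ = |c₂| * ‖V x‖ + c₁ ^ 2 * ‖Vs x‖ + c₁ ^ 2 * ‖Torus.convect V V x‖ := by
        simp only [norm_smul, Real.norm_eq_abs, abs_pow, sq_abs]
    _ ≤ β₂ * K₀ + β₁ ^ 2 * K₀' + β₁ ^ 2 * (Fintype.card d * (K₀ * K₁)) :=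
        add_le_add (add_le_add (mul_le_mul hc₂ (h0 x) (norm_nonneg _) hβ₂)
          (mul_le_mul hβ₁ (h0' x) (norm_nonneg _) (sq_nonneg _)))
          (mul_le_mul hβ₁ hconv (norm_nonneg _) (sq_nonneg _))
    _ = _ := by ring

omit [Nonempty d] in
/-- **Partial derivatives of the block force expression.** [folklore] -/
theorem norm_partialDeriv_blockForceExpr_le (hV : Torus.IsSmooth V) (hVs : Torus.IsSmooth Vs)
    (hc₁ : |c₁| ≤ β₁) (hc₂ : |c₂| ≤ β₂)
    (h0 : ∀ x, ‖V x‖ ≤ K₀) (h1 : ∀ x i, ‖Torus.partialDeriv i V x‖ ≤ K₁)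
    (h2 : ∀ x i j, ‖Torus.partialDeriv i (Torus.partialDeriv j V) x‖ ≤ K₂)
    (h1' : ∀ x i, ‖Torus.partialDeriv i Vs x‖ ≤ K₁') (i : d) (x : UnitAddTorus d) :
    ‖Torus.partialDeriv i (fun x => c₂ • V x + c₁ ^ 2 • Vs x + c₁ ^ 2 • Torus.convect V V x) x‖ ≤
      β₂ * K₁ + β₁ ^ 2 * (K₁' + Fintype.card d * (K₁ * K₁ + K₀ * K₂)) := by
  have hK₁ : 0 ≤ K₁ := (norm_nonneg _).trans (h1 x i)
  have hK₁' : 0 ≤ K₁' := (norm_nonneg _).trans (h1' x i)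
  have hβ₂ : 0 ≤ β₂ := (abs_nonneg _).trans hc₂
  have hβ₁ : c₁ ^ 2 ≤ β₁ ^ 2 := by
    rw [← sq_abs c₁]; exact pow_le_pow_left₀ (abs_nonneg _) hc₁ 2
  have hV1 : Torus.IsContDiff 1 V := hV.isContDiff (by simp)
  have hVs1 : Torus.IsContDiff 1 Vs := hVs.isContDiff (by simp)
  have hC1 : Torus.IsContDiff 1 (Torus.convect V V) := (hV.convect hV).isContDiff (by simp)
  -- expand the partial derivative
  have hexp : Torus.partialDeriv i (fun x => c₂ • V x + c₁ ^ 2 • Vs x + c₁ ^ 2 • Torus.convect V V x) x =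
      c₂ • Torus.partialDeriv i V x + c₁ ^ 2 • Torus.partialDeriv i Vs x +
        c₁ ^ 2 • Torus.partialDeriv i (Torus.convect V V) x := by
    have hf : (fun x => c₂ • V x + c₁ ^ 2 • Vs x + c₁ ^ 2 • Torus.convect V V x) =
        (c₂ • V + c₁ ^ 2 • Vs) + c₁ ^ 2 • Torus.convect V V := by
      funext y; simp
    rw [hf, Torus.partialDeriv_add ((hV1.smul c₂).add (hVs1.smul _)) (hC1.smul _),
      Torus.partialDeriv_add (hV1.smul c₂) (hVs1.smul _), Torus.partialDeriv_const_smul hV1,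
      Torus.partialDeriv_const_smul hVs1, Torus.partialDeriv_const_smul hC1]
    rfl
  have hconv : ‖Torus.partialDeriv i (Torus.convect V V) x‖ ≤ Fintype.card d * (K₁ * K₁ + K₀ * K₂) :=
    norm_partialDeriv_convect_le hV hV (h0 x) (h1 x i) (h1 x) (h2 x i)
  rw [hexp]
  calc _ ≤ ‖c₂ • Torus.partialDeriv i V x‖ + ‖c₁ ^ 2 • Torus.partialDeriv i Vs x‖ +
        ‖c₁ ^ 2 • Torus.partialDeriv i (Torus.convect V V) x‖ := norm_add₃_le
    _ = |c₂| * ‖Torus.partialDeriv i V x‖ + c₁ ^ 2 * ‖Torus.partialDeriv i Vs x‖ +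
        c₁ ^ 2 * ‖Torus.partialDeriv i (Torus.convect V V) x‖ := by
        simp only [norm_smul, Real.norm_eq_abs, abs_pow, sq_abs]
    _ ≤ β₂ * K₁ + β₁ ^ 2 * K₁' + β₁ ^ 2 * (Fintype.card d * (K₁ * K₁ + K₀ * K₂)) :=
        add_le_add (add_le_add (mul_le_mul hc₂ (h1 x i) (norm_nonneg _) hβ₂)
          (mul_le_mul hβ₁ (h1' x i) (norm_nonneg _) (sq_nonneg _)))
          (mul_le_mul hβ₁ hconv (norm_nonneg _) (sq_nonneg _))
    _ = _ := by ring

/-- **Hölder bound for the block force expression** by interpolation. [folklore] -/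
theorem eBoundedHolderNorm_blockForceExpr_le (hV : Torus.IsSmooth V) (hVs : Torus.IsSmooth Vs)
    (hc₁ : |c₁| ≤ β₁) (hc₂ : |c₂| ≤ β₂)
    (h0 : ∀ x, ‖V x‖ ≤ K₀) (h1 : ∀ x i, ‖Torus.partialDeriv i V x‖ ≤ K₁)
    (h2 : ∀ x i j, ‖Torus.partialDeriv i (Torus.partialDeriv j V) x‖ ≤ K₂)
    (h0' : ∀ x, ‖Vs x‖ ≤ K₀') (h1' : ∀ x i, ‖Torus.partialDeriv i Vs x‖ ≤ K₁')
    {r : ℝ≥0} (hr : r ≤ 1) :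
    eBoundedHolderNorm r (fun x => c₂ • V x + c₁ ^ 2 • Vs x + c₁ ^ 2 • Torus.convect V V x) ≤
      ENNReal.ofReal ((β₂ * K₀ + β₁ ^ 2 * (K₀' + Fintype.card d * (K₀ * K₁))) +
        (Real.sqrt (Fintype.card d) * (Fintype.card d *
          (β₂ * K₁ + β₁ ^ 2 * (K₁' + Fintype.card d * (K₁ * K₁ + K₀ * K₂))))) ^ (r : ℝ) *
        (2 * (β₂ * K₀ + β₁ ^ 2 * (K₀' + Fintype.card d * (K₀ * K₁)))) ^ (1 - (r : ℝ))) := by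
  have x0 : UnitAddTorus d := 0
  have hK₀ : 0 ≤ K₀ := (norm_nonneg _).trans (h0 x0)
  have hK₁ : 0 ≤ K₁ := (norm_nonneg _).trans (h1 x0 (Classical.arbitrary d))
  have hK₀' : 0 ≤ K₀' := (norm_nonneg _).trans (h0' x0)
  have hK₁' : 0 ≤ K₁' := (norm_nonneg _).trans (h1' x0 (Classical.arbitrary d))
  have hK₂ : 0 ≤ K₂ := (norm_nonneg _).trans (h2 x0 (Classical.arbitrary d) (Classical.arbitrary d))
  have hβ₂ : 0 ≤ β₂ := (abs_nonneg _).trans hc₂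
  refine eBoundedHolderNorm_le_interp (isContDiff_blockForceExpr hV hVs c₁ c₂) hr (by positivity)
    (by positivity) (norm_blockForceExpr_le hV hc₁ hc₂ h0 h1 h0') ?_
  exact fun i x => norm_partialDeriv_blockForceExpr_le hV hVs hc₁ hc₂ h0 h1 h2 h1' i x

omit [Nonempty d] in
/-- **Hölder bound for the Laplacian of a block** by interpolation: with `‖∂ᵢ∂ⱼV‖ ≤ K₂`,
`‖∂ᵢ∂ⱼ∂ₗV‖ ≤ K₃`, `‖ΔV‖_{C^{0,r}} ≤ d K₂ + (√d d (d K₃))^r (2 d K₂)^{1-r}`. [folklore] -/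
theorem eBoundedHolderNorm_laplacian_le (hV : Torus.IsSmooth V)
    (h2 : ∀ x i j, ‖Torus.partialDeriv i (Torus.partialDeriv j V) x‖ ≤ K₂)
    (h3 : ∀ x i j l, ‖Torus.partialDeriv i (Torus.partialDeriv j (Torus.partialDeriv l V)) x‖ ≤ K₃)
    (hK₂ : 0 ≤ K₂) (hK₃ : 0 ≤ K₃) {r : ℝ≥0} (hr : r ≤ 1) :
    eBoundedHolderNorm r (Torus.laplacian V) ≤
      ENNReal.ofReal (Fintype.card d * K₂ +
        (Real.sqrt (Fintype.card d) * (Fintype.card d * (Fintype.card d * K₃))) ^ (r : ℝ) *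
          (2 * (Fintype.card d * K₂)) ^ (1 - (r : ℝ))) :=
  eBoundedHolderNorm_le_interp ((hV.laplacian).isContDiff (by simp)) hr (by positivity) (by positivity)
    (fun x => norm_laplacian_le hV fun i => h2 x i i)
    (fun j x => norm_partialDeriv_laplacian_le hV fun i => h3 x j i i)

end BlockForce

/-! ### The block forces `blockForce v n` in `C^{0,r}` (Cheskidov 2023, (3.11); BDL Lemma 5.1) -/

section BlockForceBounds

variable [Nonempty d]

omit [Nonempty d] [DecidableEq d] in
/-- The block force is the block force expression with `c₁ = σₙ'(t)`, `c₂ = σₙ''(t)`,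
`V = vₙ(σₙ(t))`, `Vs = ∂ₛvₙ(σₙ(t))`. [cite: Cheskidov2023, §3 (3.11)] -/
theorem blockForce_eq_expr (hv : Torus.IsSmoothSpaceTimeOn (Icc 0 1) (v n)) (t : ℝ) :
    blockForce v n t = fun x => deriv (deriv (sigma n)) t • v n (sigma n t) x +
      deriv (sigma n) t ^ 2 • Torus.timeDerivWithin (Icc 0 1) (v n) (sigma n t) x +
      deriv (sigma n) t ^ 2 • Torus.convect (v n (sigma n t)) (v n (sigma n t)) x := by
  funext x
  have hv1 : Torus.IsContDiff 1 (v n (sigma n t)) := (hv.isSmooth_slice (sigma_mem_Icc n t)).isContDiff (by simp)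
  have heq : blockDrift v n t = deriv (sigma n) t • v n (sigma n t) := rfl
  rw [blockForce, heq, convect_const_smul_const_smul hv1, smul_smul, sq]

/-- **The block force in sup norm and in `C^{0,r}`**: with `P = (n+1)(n+2)`,
`‖blockForce v n (t)‖_∞ ≤ P² 5⁻ⁿ A₁` and
`‖blockForce v n (t)‖_{C^{0,r}} ≤ M + (√d d L)^r (2M)^{1-r}`, `M = P² 5⁻ⁿ A₁`, `L = P² A₂`,
`A₁ = Bσ'A + Bσ²(A + dA²)`, `A₂ = Bσ'A + Bσ²(A + 2dA²)` (Cheskidov 2023, (3.11) with Thm. 3.1 (a);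
Bruè–De Lellis 2023, Lemma 5.1: `‖∂ₜṽ + ṽ·∇ṽ‖_{C^α} ≲ poly(n) λₙ^{α-1}` on block `n`). [cite: Cheskidov2023, §3 (3.11)] -/
theorem blockForce_bounds (hv : Torus.IsSmoothSpaceTimeOn (Icc 0 1) (v n)) (hK : BlockDerivBounds v A)
    (hBσ : ∀ n t, |deriv (sigma n) t| ≤ Bσ / tau n)
    (hBσ' : ∀ n t, |deriv (deriv (sigma n)) t| ≤ Bσ' / tau n ^ 2) (t : ℝ) {r : ℝ≥0} (hr : r ≤ 1) :
    (∀ x, ‖blockForce v n t x‖ ≤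
      (((n : ℝ) + 1) * (n + 2)) ^ 2 * (5 ^ n)⁻¹ * (Bσ' * A + Bσ ^ 2 * (A + Fintype.card d * A ^ 2))) ∧
    eBoundedHolderNorm r (blockForce v n t) ≤
      ENNReal.ofReal
        ((((n : ℝ) + 1) * (n + 2)) ^ 2 * (5 ^ n)⁻¹ * (Bσ' * A + Bσ ^ 2 * (A + Fintype.card d * A ^ 2)) +
          (Real.sqrt (Fintype.card d) * (Fintype.card d *
            ((((n : ℝ) + 1) * (n + 2)) ^ 2 * (Bσ' * A + Bσ ^ 2 * (A + 2 * Fintype.card d * A ^ 2))))) ^ (r : ℝ) *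
          (2 * ((((n : ℝ) + 1) * (n + 2)) ^ 2 * (5 ^ n)⁻¹ *
            (Bσ' * A + Bσ ^ 2 * (A + Fintype.card d * A ^ 2)))) ^ (1 - (r : ℝ))) := by
  have hs := sigma_mem_Icc n t
  set V := v n (sigma n t) with hVdef
  set Vs := Torus.timeDerivWithin (Icc 0 1) (v n) (sigma n t) with hVsdef
  have hVsm : Torus.IsSmooth V := hv.isSmooth_slice hs
  have hVssm : Torus.IsSmooth Vs := hv.isSmooth_timeDerivWithin (uniqueDiffOn_Icc zero_lt_one) hs
  have hA := hK.nonneg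
  have hc₁ : |deriv (sigma n) t| ≤ Bσ * (((n : ℝ) + 1) * (n + 2)) := by
    have := hBσ n t; rwa [div_tau] at this
  have hc₂ : |deriv (deriv (sigma n)) t| ≤ Bσ' * (((n : ℝ) + 1) * (n + 2)) ^ 2 := by
    have := hBσ' n t
    rwa [show Bσ' / tau n ^ 2 = Bσ' * (((n : ℝ) + 1) * (n + 2)) ^ 2 by unfold tau; field_simp] at this
  have hB' := nonneg_of_abs_deriv_deriv_sigma_le hBσ'
  have hfun := blockForce_eq_expr hv t
  have hq : (5 : ℝ) ^ n ≠ 0 := by positivity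
  set P : ℝ := ((n : ℝ) + 1) * (n + 2) with hP
  have h0 : ∀ x, ‖V x‖ ≤ A / 5 ^ n := fun x => hK.sup_le n _ hs x
  have h0' : ∀ x, ‖Vs x‖ ≤ A / 5 ^ n := fun x => hK.timeDeriv_le n _ hs x
  have hM : ∀ x, ‖deriv (deriv (sigma n)) t • V x + deriv (sigma n) t ^ 2 • Vs x +
      deriv (sigma n) t ^ 2 • Torus.convect V V x‖ ≤
      P ^ 2 * (5 ^ n)⁻¹ * (Bσ' * A + Bσ ^ 2 * (A + Fintype.card d * A ^ 2)) := fun x =>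
    (norm_blockForceExpr_le hVsm hc₁ hc₂ h0 (fun x i => hK.partialDeriv_le n _ hs x i) h0' x).trans
      (le_of_eq (by field_simp))
  have hL : ∀ i x, ‖Torus.partialDeriv i (fun x => deriv (deriv (sigma n)) t • V x +
      deriv (sigma n) t ^ 2 • Vs x + deriv (sigma n) t ^ 2 • Torus.convect V V x) x‖ ≤
      P ^ 2 * (Bσ' * A + Bσ ^ 2 * (A + 2 * Fintype.card d * A ^ 2)) := fun i x =>
    (norm_partialDeriv_blockForceExpr_le hVsm hVssm hc₁ hc₂ h0 (fun x i => hK.partialDeriv_le n _ hs x i)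
      (fun x i j => hK.partialDeriv_two_le n _ hs x i j) (fun x i => hK.partialDeriv_timeDeriv_le n _ hs x i)
      i x).trans (le_of_eq (by field_simp; ring))
  refine ⟨fun x => ?_, ?_⟩
  · have := hM x; rwa [← congrFun hfun x] at this
  · rw [hfun]
    exact eBoundedHolderNorm_le_interp (isContDiff_blockForceExpr hVsm hVssm _ _) hr (by positivity)
      (by positivity) hM hL

/-- **The block forces are bounded**: `‖blockForce v n (t,x)‖ ≤ 8 A₁` (since `P² 5⁻ⁿ ≤ 8`). [cite: Cheskidov2023, §3 (3.11)] -/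
theorem norm_blockForce_le_const (hv : Torus.IsSmoothSpaceTimeOn (Icc 0 1) (v n)) (hK : BlockDerivBounds v A)
    (hBσ : ∀ n t, |deriv (sigma n) t| ≤ Bσ / tau n)
    (hBσ' : ∀ n t, |deriv (deriv (sigma n)) t| ≤ Bσ' / tau n ^ 2) (t : ℝ) (x : UnitAddTorus d) :
    ‖blockForce v n t x‖ ≤ 8 * (Bσ' * A + Bσ ^ 2 * (A + Fintype.card d * A ^ 2)) := by
  have h := (blockForce_bounds hv hK hBσ hBσ' t le_rfl (r := 1)).1 x
  refine h.trans (mul_le_mul_of_nonneg_right ?_ ?_)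
  · rw [mul_inv_le_iff₀ (by positivity)]
    exact sq_succ_mul_succ_le_eight_mul_pow _
  · have hA := hK.nonneg
    have hB' := nonneg_of_abs_deriv_deriv_sigma_le hBσ'
    positivity

/-- **The limit force is bounded**: `‖g(t,x)‖ ≤ 8 A₁` for all `t`, `x` (Cheskidov 2023, (3.11);
`g = 0` outside `[0,1)`). [cite: Cheskidov2023, §3 (3.11)] -/
theorem norm_limForce_le_const (hB : Blocks ρ v) (hK : BlockDerivBounds v A)
    (hBσ : ∀ n t, |deriv (sigma n) t| ≤ Bσ / tau n)
    (hBσ' : ∀ n t, |deriv (deriv (sigma n)) t| ≤ Bσ' / tau n ^ 2) (t : ℝ) (x : UnitAddTorus d) :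
    ‖limForce v t x‖ ≤ 8 * (Bσ' * A + Bσ ^ 2 * (A + Fintype.card d * A ^ 2)) := by
  unfold limForce
  split_ifs with h
  · exact norm_blockForce_le_const (hB.sol _).smooth_velocity hK hBσ hBσ' t x
  · rw [norm_zero]
    have hA := hK.nonneg
    have hB' := nonneg_of_abs_deriv_deriv_sigma_le hBσ'
    positivity

end BlockForceBounds

/-! ### Decay of the force bounds along the blocks -/

section Decay

/-- `((n+1)(n+2))² ρⁿ → 0` for `0 ≤ ρ < 1`. [folklore] -/
theorem tendsto_poly_sq_mul_pow {ρ : ℝ} (h0 : 0 ≤ ρ) (h1 : ρ < 1) :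
    Tendsto (fun n : ℕ => (((n : ℝ) + 1) * (n + 2)) ^ 2 * ρ ^ n) atTop (𝓝 0) := by
  have hb : ∀ n : ℕ, (((n : ℝ) + 1) * (n + 2)) ^ 2 * ρ ^ n ≤ 72 * ((n : ℝ) ^ 4 * ρ ^ n) + 8 * ρ ^ n := by
    intro n
    have hn2 : (n : ℝ) ≤ (n : ℝ) ^ 2 := by
      have h := Nat.le_mul_self n
      have : (n : ℝ) ≤ (n : ℝ) * n := by exact_mod_cast h
      simpa [sq] using this
    have hpoly : ((n : ℝ) + 1) * (n + 2) ≤ 6 * (n : ℝ) ^ 2 + 2 := by nlinarith [n.cast_nonneg (α := ℝ)]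
    have hpoly2 : (((n : ℝ) + 1) * (n + 2)) ^ 2 ≤ 72 * (n : ℝ) ^ 4 + 8 := by
      have h0 : 0 ≤ ((n : ℝ) + 1) * (n + 2) := by positivity
      nlinarith [sq_nonneg ((n : ℝ) ^ 2), sq_nonneg (6 * (n : ℝ) ^ 2 - 2)]
    have hq : 0 ≤ ρ ^ n := pow_nonneg h0 n
    calc _ ≤ (72 * (n : ℝ) ^ 4 + 8) * ρ ^ n := mul_le_mul_of_nonneg_right hpoly2 hq
      _ = _ := by ring
  have hl : Tendsto (fun n : ℕ => 72 * ((n : ℝ) ^ 4 * ρ ^ n) + 8 * ρ ^ n) atTop (𝓝 0) := by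
    have t1 := tendsto_pow_const_mul_const_pow_of_lt_one 4 h0 h1
    have t2 := tendsto_pow_atTop_nhds_zero_of_lt_one h0 h1
    simpa using (t1.const_mul 72).add (t2.const_mul 8)
  exact squeeze_zero (fun n => by positivity) hb hl

/-- Algebra of the interpolated bound: `(a X)^r (b X y)^{1-r} = a^r b^{1-r} X y^{1-r}` for
`X > 0`, `a, b, y ≥ 0`. [folklore] -/
theorem rpow_interp_eq {a b X y r : ℝ} (ha : 0 ≤ a) (hb : 0 ≤ b) (hX : 0 < X) (hy : 0 ≤ y) :
    (a * X) ^ r * (b * X * y) ^ (1 - r) = a ^ r * b ^ (1 - r) * X * y ^ (1 - r) := by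
  rw [Real.mul_rpow ha hX.le, Real.mul_rpow (by positivity) hy, Real.mul_rpow hb hX.le]
  have hX1 : X ^ r * X ^ (1 - r) = X := by
    rw [← Real.rpow_add hX]; simp
  calc a ^ r * X ^ r * (b ^ (1 - r) * X ^ (1 - r) * y ^ (1 - r))
      = a ^ r * b ^ (1 - r) * (X ^ r * X ^ (1 - r)) * y ^ (1 - r) := by ring
    _ = _ := by rw [hX1]

/-- **The profile force bound decays along the blocks**: for `0 ≤ r < 1` and nonnegative
constants, `M n + (c L n)^r (2 M n)^{1-r} → 0` where `M n = P² 5⁻ⁿ A₁`, `L n = P² A₂`,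
`P = (n+1)(n+2)` (Bruè–De Lellis 2023, Lemma 5.1: `poly(n) λₙ^{α-1} → 0`). [folklore] -/
theorem tendsto_profileForceBound {A₁ A₂ c r : ℝ} (hA₁ : 0 ≤ A₁) (hA₂ : 0 ≤ A₂) (hc : 0 ≤ c)
    (hr1 : r < 1) :
    Tendsto (fun n : ℕ =>
      (((n : ℝ) + 1) * (n + 2)) ^ 2 * (5 ^ n)⁻¹ * A₁ +
        (c * ((((n : ℝ) + 1) * (n + 2)) ^ 2 * A₂)) ^ r *
          (2 * ((((n : ℝ) + 1) * (n + 2)) ^ 2 * (5 ^ n)⁻¹ * A₁)) ^ (1 - r)) atTop (𝓝 0) := by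
  have h5 : ∀ n : ℕ, ((5 : ℝ) ^ n)⁻¹ = (5⁻¹ : ℝ) ^ n := fun n => by rw [inv_pow]
  -- first term
  have t1 : Tendsto (fun n : ℕ => (((n : ℝ) + 1) * (n + 2)) ^ 2 * (5 ^ n)⁻¹ * A₁) atTop (𝓝 0) := by
    have := (tendsto_poly_sq_mul_pow (by norm_num : (0 : ℝ) ≤ 5⁻¹) (by norm_num)).mul_const A₁
    rw [zero_mul] at this
    exact this.congr fun n => by rw [h5]
  -- second term: rewrite as `const · P² · ρⁿ`
  set ρ : ℝ := (5⁻¹ : ℝ) ^ (1 - r) with hρ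
  have hρ0 : 0 ≤ ρ := Real.rpow_nonneg (by norm_num) _
  have hρ1 : ρ < 1 := Real.rpow_lt_one (by norm_num) (by norm_num) (by linarith)
  have heq : ∀ n : ℕ, (c * ((((n : ℝ) + 1) * (n + 2)) ^ 2 * A₂)) ^ r *
      (2 * ((((n : ℝ) + 1) * (n + 2)) ^ 2 * (5 ^ n)⁻¹ * A₁)) ^ (1 - r) =
      (c * A₂) ^ r * (2 * A₁) ^ (1 - r) * ((((n : ℝ) + 1) * (n + 2)) ^ 2 * ρ ^ n) := by
    intro n
    have hX : 0 < (((n : ℝ) + 1) * (n + 2)) ^ 2 := by positivity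
    have e1 : c * ((((n : ℝ) + 1) * (n + 2)) ^ 2 * A₂) = (c * A₂) * (((n : ℝ) + 1) * (n + 2)) ^ 2 := by ring
    have e2 : 2 * ((((n : ℝ) + 1) * (n + 2)) ^ 2 * (5 ^ n)⁻¹ * A₁) =
        (2 * A₁) * (((n : ℝ) + 1) * (n + 2)) ^ 2 * (5⁻¹ : ℝ) ^ n := by rw [h5]; ring
    rw [e1, e2, rpow_interp_eq (by positivity) (by positivity) hX (by positivity)]
    have e3 : ((5⁻¹ : ℝ) ^ n) ^ (1 - r) = ρ ^ n := by
      rw [hρ, ← Real.rpow_natCast, ← Real.rpow_natCast, ← Real.rpow_mul (by norm_num),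
        ← Real.rpow_mul (by norm_num), mul_comm]
    rw [e3]; ring
  have t2 : Tendsto (fun n : ℕ => (c * ((((n : ℝ) + 1) * (n + 2)) ^ 2 * A₂)) ^ r *
      (2 * ((((n : ℝ) + 1) * (n + 2)) ^ 2 * (5 ^ n)⁻¹ * A₁)) ^ (1 - r)) atTop (𝓝 0) := by
    have := (tendsto_poly_sq_mul_pow hρ0 hρ1).const_mul ((c * A₂) ^ r * (2 * A₁) ^ (1 - r))
    rw [mul_zero] at this
    exact this.congr fun n => (heq n).symm
  simpa using t1.add t2

end Decay

/-! ### The viscous term `ν Δ(blockDrift v n)` on the blocks `n ≤ m` (Cheskidov 2023, (3.13)) -/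

section Viscous

omit [Fintype d] [DecidableEq d] in
/-- Crude bound for real powers with exponent in `[0,1]`: `x^s ≤ x + 1` for `x ≥ 0`. [folklore] -/
theorem rpow_le_add_one {x s : ℝ} (hx : 0 ≤ x) (hs0 : 0 ≤ s) (hs1 : s ≤ 1) : x ^ s ≤ x + 1 := by
  rcases le_or_gt 1 x with h | h
  · calc x ^ s ≤ x ^ (1 : ℝ) := Real.rpow_le_rpow_of_exponent_le h hs1
      _ = x := Real.rpow_one x
      _ ≤ x + 1 := by linarith
  · calc x ^ s ≤ 1 := Real.rpow_le_one hx h.le hs0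
      _ ≤ x + 1 := by linarith

/-- **The viscous term on a block in `C^{0,r}`**: for `n ≤ m`, `ν ≥ 0`, `r ≤ 1`,
`‖ν Δ(blockDrift v n (t))‖_{C^{0,r}} ≤ ν Bσ (m+1)(m+2) E 125ᵐ` with
`E = (dA + 1) + (√d d² A + 1)(2 d A + 1)` (Cheskidov 2023, (3.13) with Thm. 3.1 (a), `α ∈ {2,3}`:
`ν_m‖Δṽ^m‖_{C^α} ≲ ν_m poly(m) λ_m^{1+α}`; crude but sufficient, the viscosities being chosen
afterwards). [cite: Cheskidov2023, §3 (3.13)] -/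
theorem eBoundedHolderNorm_viscous_le (hv : Torus.IsSmoothSpaceTimeOn (Icc 0 1) (v n))
    (hK : BlockDerivBounds v A) (hBσ : ∀ n t, |deriv (sigma n) t| ≤ Bσ / tau n) (hnm : n ≤ m)
    {ν : ℝ} (hν : 0 ≤ ν) (t : ℝ) {r : ℝ≥0} (hr : r ≤ 1) :
    eBoundedHolderNorm r (fun x => ν • Torus.laplacian (blockDrift v n t) x) ≤
      ENNReal.ofReal (ν * (Bσ * (((m : ℝ) + 1) * (m + 2)) *
        (((Fintype.card d * A + 1) + (Real.sqrt (Fintype.card d) * Fintype.card d ^ 2 * A + 1) *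
          (2 * Fintype.card d * A + 1)) * 125 ^ m))) := by
  have hs := sigma_mem_Icc n t
  set V := v n (sigma n t)
  have hVsm : Torus.IsSmooth V := hv.isSmooth_slice hs
  have hA := hK.nonneg
  have hc := hBσ n t; rw [div_tau] at hc
  have hB0 := nonneg_of_abs_deriv_sigma_le hBσ
  -- `ν Δ(c₁ V) = (ν c₁) • ΔV`
  have hfun : (fun x => ν • Torus.laplacian (blockDrift v n t) x) =
      (ν * deriv (sigma n) t) • Torus.laplacian V := by
    funext x
    have heq : blockDrift v n t = deriv (sigma n) t • V := rfl
    rw [heq, Torus.laplacian_const_smul' hVsm, Pi.smul_apply, smul_smul]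
  rw [hfun, eBoundedHolderNorm_const_smul]
  have hΔ := eBoundedHolderNorm_laplacian_le (K₂ := A * 5 ^ n) (K₃ := A * 25 ^ n) hVsm
    (fun x i j => hK.partialDeriv_two_le n _ hs x i j) (fun x i j l => hK.partialDeriv_three_le n _ hs x i j l)
    (by positivity) (by positivity) hr
  set d' : ℝ := (Fintype.card d : ℝ) with hd'
  have hd0 : 0 ≤ d' := Nat.cast_nonneg _
  have hH : d' * (A * 5 ^ n) + (Real.sqrt d' * (d' * (d' * (A * 25 ^ n)))) ^ (r : ℝ) *
      (2 * (d' * (A * 5 ^ n))) ^ (1 - (r : ℝ)) ≤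
      ((d' * A + 1) + (Real.sqrt d' * d' ^ 2 * A + 1) * (2 * d' * A + 1)) * 125 ^ n := by
    have h5 : (1 : ℝ) ≤ 5 ^ n := one_le_pow₀ (by norm_num)
    have h25 : (1 : ℝ) ≤ 25 ^ n := one_le_pow₀ (by norm_num)
    have hx := rpow_le_add_one (x := Real.sqrt d' * (d' * (d' * (A * 25 ^ n)))) (s := r)
      (by positivity) r.2 hr
    have hy := rpow_le_add_one (x := 2 * (d' * (A * 5 ^ n))) (s := 1 - r) (by positivity)
      (by simpa using hr) (by simp)
    have e125 : (125 : ℝ) ^ n = 25 ^ n * 5 ^ n := by rw [← mul_pow]; norm_num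
    calc _ ≤ d' * (A * 5 ^ n) + (Real.sqrt d' * (d' * (d' * (A * 25 ^ n))) + 1) * (2 * (d' * (A * 5 ^ n)) + 1) :=
          add_le_add le_rfl (mul_le_mul hx hy (by positivity) (by positivity))
      _ ≤ (d' * A + 1) * 125 ^ n + ((Real.sqrt d' * d' ^ 2 * A + 1) * 25 ^ n) * ((2 * d' * A + 1) * 5 ^ n) := by
          refine add_le_add ?_ (mul_le_mul ?_ ?_ (by positivity) (by positivity))
          · have : (5 : ℝ) ^ n ≤ 125 ^ n := pow_le_pow_left₀ (by norm_num) (by norm_num) n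
            nlinarith [mul_nonneg hd0 hA]
          · nlinarith [mul_nonneg (mul_nonneg (Real.sqrt_nonneg d') (sq_nonneg d')) hA]
          · nlinarith [mul_nonneg hd0 hA]
      _ = _ := by rw [e125]; ring
  have hmono : ((n : ℝ) + 1) * (n + 2) * (125 : ℝ) ^ n ≤ ((m : ℝ) + 1) * (m + 2) * 125 ^ m := by
    have hnm' : (n : ℝ) ≤ m := by exact_mod_cast hnm
    exact mul_le_mul (by nlinarith) (pow_le_pow_right₀ (by norm_num) hnm) (by positivity) (by positivity)
  set E : ℝ := (d' * A + 1) + (Real.sqrt d' * d' ^ 2 * A + 1) * (2 * d' * A + 1) with hE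
  have hE0 : 0 ≤ E := by positivity
  calc ‖ν * deriv (sigma n) t‖ₑ * eBoundedHolderNorm r (Torus.laplacian V)
      ≤ ENNReal.ofReal (ν * (Bσ * (((n : ℝ) + 1) * (n + 2)))) * ENNReal.ofReal (E * 125 ^ n) := by
        refine mul_le_mul' ?_ (hΔ.trans (ENNReal.ofReal_le_ofReal hH))
        rw [← ofReal_norm, Real.norm_eq_abs, abs_mul, abs_of_nonneg hν]
        exact ENNReal.ofReal_le_ofReal (mul_le_mul_of_nonneg_left hc hν)
    _ = ENNReal.ofReal (ν * Bσ * ((((n : ℝ) + 1) * (n + 2)) * 125 ^ n) * E) := by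
        rw [← ENNReal.ofReal_mul (by positivity)]; ring_nf
    _ ≤ ENNReal.ofReal (ν * Bσ * ((((m : ℝ) + 1) * (m + 2)) * 125 ^ m) * E) := by gcongr
    _ = _ := by ring_nf

end Viscous

/-! ### Dissipation integrands of the glued fields (Cheskidov 2023, Lemma 3.2 (3.16), (3.6)) -/

section Dissipation

/-- **Gradient of the glued drift**: `gradNormSq (v^m(t)) ≤ d (Bσ (m+1)(m+2) A)²` for every `t`
(at most one block `j ≤ m` moves, `∂ᵢ(σⱼ' vⱼ) = σⱼ' ∂ᵢvⱼ`; Cheskidov 2023, Lemma 3.2: `{v^m}`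
bounded in `L²H¹` up to the gluing factors). [cite: Cheskidov2023, Lemma 3.2 (3.16)] -/
theorem gradNormSq_drift_le (hB : Blocks ρ v) (hK : BlockDerivBounds v A)
    (hBσ : ∀ n t, |deriv (sigma n) t| ≤ Bσ / tau n) (m : ℕ) (t : ℝ) :
    Torus.gradNormSq (drift v m t) ≤ Fintype.card d * (Bσ * (((m : ℝ) + 1) * (m + 2)) * A) ^ 2 := by
  have hA := hK.nonneg
  have hB0 := nonneg_of_abs_deriv_sigma_le hBσ
  -- `v^m(t) = c • v_j(s)` with `|c| ≤ Bσ (m+1)(m+2)`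
  obtain ⟨j, s, hs, c, hc, heq⟩ : ∃ j s, s ∈ Icc (0 : ℝ) 1 ∧ ∃ c : ℝ,
      |c| ≤ Bσ * (((m : ℝ) + 1) * (m + 2)) ∧ drift v m t = c • v j s := by
    by_cases hpos : 0 ≤ t ∧ t < tn (m + 1)
    · have ht1 : t < 1 := hpos.2.trans (tn_lt_one _)
      have hmem := mem_Ico_tn_blockIdx hpos.1 ht1
      have hjm := blockIdx_le_of_lt_tn_succ hpos.2
      refine ⟨blockIdx t, sigma (blockIdx t) t, sigma_mem_Icc _ _, deriv (sigma (blockIdx t)) t, ?_,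
        drift_eq_blockDrift v hjm hmem⟩
      have h := hBσ (blockIdx t) t; rw [div_tau] at h
      refine h.trans (mul_le_mul_of_nonneg_left ?_ hB0)
      have : (blockIdx t : ℝ) ≤ m := by exact_mod_cast hjm
      nlinarith
    · refine ⟨0, 0, ⟨le_rfl, zero_le_one⟩, 0, by rw [abs_zero]; positivity, ?_⟩
      rw [zero_smul]
      rw [not_and_or, not_le, not_lt] at hpos
      rcases hpos with h | h
      · exact drift_eq_zero_of_nonpos v h.le
      · exact drift_eq_zero_of_ge v h
  have hV1 : Torus.IsContDiff 1 (v j s) := ((hB.sol j).smooth_velocity.isSmooth_slice hs).isContDiff (by simp)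
  have hpt : ∀ x, ∑ i, ‖Torus.partialDeriv i (drift v m t) x‖ ^ 2 ≤
      Fintype.card d * (Bσ * (((m : ℝ) + 1) * (m + 2)) * A) ^ 2 := by
    intro x
    have : ∀ i, ‖Torus.partialDeriv i (drift v m t) x‖ ^ 2 ≤ (Bσ * (((m : ℝ) + 1) * (m + 2)) * A) ^ 2 := by
      intro i
      rw [heq, Torus.partialDeriv_const_smul hV1, Pi.smul_apply, norm_smul, Real.norm_eq_abs]
      exact pow_le_pow_left₀ (by positivity) (mul_le_mul hc (hK.partialDeriv_le j s hs x i) (norm_nonneg _)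
        (by positivity)) 2
    calc _ ≤ ∑ _i : d, (Bσ * (((m : ℝ) + 1) * (m + 2)) * A) ^ 2 := Finset.sum_le_sum fun i _ => this i
      _ = _ := by simp only [Finset.sum_const, Finset.card_univ, nsmul_eq_mul]
  unfold Torus.gradNormSq
  calc _ ≤ ∫ _x : UnitAddTorus d, (Fintype.card d : ℝ) * (Bσ * (((m : ℝ) + 1) * (m + 2)) * A) ^ 2 :=
        integral_mono_of_nonneg (ae_of_all _ fun x => Finset.sum_nonneg fun i _ => by positivity)
          (integrable_const _) (ae_of_all _ hpt)
    _ = _ := by simp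

/-- Every value of the glued profile `ρ^m` is a value of some block `j ≤ m` at an internal time
`s ∈ [0,1]` (for all real `t`). [cite: Cheskidov2023, §3 (3.5)] -/
theorem exists_profile_eq (hB : Blocks ρ v) (m : ℕ) (t : ℝ) : ∃ j ≤ m, ∃ s ∈ Icc (0 : ℝ) 1, profile ρ m t = ρ j s := by
  by_cases h0 : 0 ≤ t
  · rcases le_or_gt t (tn (m + 1)) with h1 | h1
    · obtain ⟨j, hj, hmem⟩ := exists_mem_Icc_tn_of_le h0 h1
      exact ⟨j, hj, sigma j t, sigma_mem_Icc _ _, profile_eq_blockProfile hB hj hmem⟩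
    · exact ⟨m, le_rfl, 1, ⟨zero_le_one, le_rfl⟩, profile_eq_of_ge hB h1.le⟩
  · exact ⟨0, Nat.zero_le _, 0, ⟨le_rfl, zero_le_one⟩, profile_eq_of_nonpos ρ (not_le.1 h0).le⟩

/-- **Gradient of the glued profile** for every `t`: `scalarGradNormSq (ρ^m(t)) ≤ (C 5ᵐ)²`
(Cheskidov 2023, (3.6): `‖∇ρ̃^m(t)‖_∞ ≤ Cλ_m`; cf. `scalarGradNormSq_profile_le` on the gluing
intervals). [cite: Cheskidov2023, §3 (3.6)] -/
theorem scalarGradNormSq_profile_le_sq (hB : Blocks ρ v) {C : ℝ}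
    (hC : ∀ n : ℕ, ∀ s ∈ Icc (0 : ℝ) 1, ∀ x, ‖Torus.gradient (ρ n s) x‖ ≤ C * 5 ^ n) (m : ℕ) (t : ℝ) :
    Torus.scalarGradNormSq (profile ρ m t) ≤ (C * 5 ^ m) ^ 2 := by
  obtain ⟨j, hj, s, hs, heq⟩ := exists_profile_eq hB m t
  have hC0 : 0 ≤ C := by
    have := hC 0 0 ⟨le_rfl, zero_le_one⟩ 0
    rw [pow_zero, mul_one] at this
    exact (norm_nonneg _).trans this
  have hpt : ∀ x, ‖Torus.gradient (profile ρ m t) x‖ ^ 2 ≤ (C * 5 ^ m) ^ 2 := fun x => by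
    rw [heq]
    refine pow_le_pow_left₀ (norm_nonneg _) ((hC j s hs x).trans ?_) 2
    exact mul_le_mul_of_nonneg_left (pow_le_pow_right₀ (by norm_num) hj) hC0
  unfold Torus.scalarGradNormSq
  calc _ ≤ ∫ _x : UnitAddTorus d, (C * 5 ^ m) ^ 2 :=
        integral_mono_of_nonneg (ae_of_all _ fun x => by positivity) (integrable_const _) (ae_of_all _ hpt)
    _ = _ := by simp

end Dissipation

/-! ### The glued and limit profiles: norms, means, `Ḣ⁻¹` decay and the weak limit `ρ̃(t) ⇀ 0` -/

section Scalars

/-- Slices of the glued profile for every real `t`: zero mean, unit `L²` norm, `|ρ^m| ≤ 10`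
(Cheskidov 2023, Thm. 3.1 (b) block by block; cf. `hasZeroMean_profile_and_integral_sq` on
`[0, tₘ₊₁]`). [cite: Cheskidov2023, §3 (3.6)] -/
theorem profile_slice (hB : Blocks ρ v)
    (hb : ∀ n : ℕ, ∀ s ∈ Icc (0 : ℝ) 1,
      Torus.HasZeroMean (ρ n s) ∧ ∫ x, ρ n s x ^ 2 = 1 ∧ ∀ x, |ρ n s x| ≤ 10) (m : ℕ) (t : ℝ) :
    Torus.HasZeroMean (profile ρ m t) ∧ ∫ x, profile ρ m t x ^ 2 = 1 ∧ ∀ x, |profile ρ m t x| ≤ 10 := by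
  obtain ⟨j, -, s, hs, heq⟩ := exists_profile_eq hB m t
  rw [heq]; exact hb j s hs

omit [DecidableEq d] in
/-- Slices of the limit profile: zero mean, unit `L²` norm, `|ρ̃| ≤ 10`, and
`‖ρ̃(t)‖_{Ḣ⁻¹} ≤ C 5^{-blockIdx t}` (Cheskidov 2023, Thm. 3.1 (b) transported by (3.8)). [cite: Cheskidov2023, §3 (3.8)] -/
theorem limProfile_slice
    (hb : ∀ n : ℕ, ∀ s ∈ Icc (0 : ℝ) 1,
      Torus.HasZeroMean (ρ n s) ∧ ∫ x, ρ n s x ^ 2 = 1 ∧ ∀ x, |ρ n s x| ≤ 10)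
    {C : ℝ} (hH : ∀ n : ℕ, ∀ s ∈ Icc (0 : ℝ) 1,
      Torus.eHomSobolevSeminorm (-1) (fun x => (ρ n s x : ℂ)) ≤ ENNReal.ofReal (C * (5 ^ n)⁻¹)) (t : ℝ) :
    Torus.HasZeroMean (limProfile ρ t) ∧ ∫ x, limProfile ρ t x ^ 2 = 1 ∧ (∀ x, |limProfile ρ t x| ≤ 10) ∧
      Torus.eHomSobolevSeminorm (-1) (fun x => (limProfile ρ t x : ℂ)) ≤
        ENNReal.ofReal (C * (5 ^ blockIdx t)⁻¹) := by
  have h := hb (blockIdx t) _ (sigma_mem_Icc (blockIdx t) t)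
  exact ⟨h.1, h.2.1, h.2.2, hH (blockIdx t) _ (sigma_mem_Icc (blockIdx t) t)⟩

/-- **The limit profile converges weakly to zero at the blow-up time**: `∫ ρ̃(t) w → 0` as
`t → 1⁻` for every real `w ∈ L²(T^d)` (Cheskidov 2023, (3.10): `ρ̃(t) ⇀ 0`; from
`‖ρ̃(t)‖_{Ḣ⁻¹} ≤ Cλₙ⁻¹ → 0`, zero means and unit `L²` norms). [cite: Cheskidov2023, §3 (3.10)] -/
theorem tendsto_integral_limProfile_mul (hB : Blocks ρ v)
    (hb : ∀ n : ℕ, ∀ s ∈ Icc (0 : ℝ) 1,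
      Torus.HasZeroMean (ρ n s) ∧ ∫ x, ρ n s x ^ 2 = 1 ∧ ∀ x, |ρ n s x| ≤ 10)
    {C : ℝ} (hH : ∀ n : ℕ, ∀ s ∈ Icc (0 : ℝ) 1,
      Torus.eHomSobolevSeminorm (-1) (fun x => (ρ n s x : ℂ)) ≤ ENNReal.ofReal (C * (5 ^ n)⁻¹))
    {w : UnitAddTorus d → ℝ} (hw : MemLp w 2 volume) :
    Tendsto (fun t => ∫ x, limProfile ρ t x * w x) (𝓝[<] 1) (𝓝 0) := by
  have hsm : ∀ t, Torus.IsSmooth (limProfile ρ t) := fun t =>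
    (hB.sol _).smooth_scalar.isSmooth_slice (sigma_mem_Icc (blockIdx t) t)
  refine Torus.tendsto_integral_mul_of_tendsto_mFourierCoeff (M := 1) (fun t => (hsm t).memLp 2)
    (fun t => (limProfile_slice hb hH t).2.1.le) ?_ hw
  refine Torus.tendsto_mFourierCoeff_of_tendsto_eHomSobolevSeminorm ?_ ?_
  · -- `Ḣ⁻¹` seminorms tend to zero (the constant is nonnegative as soon as it bounds a seminorm
    -- of a nonzero function; we avoid this by bounding with `max C 0`)
    have hlim : Tendsto (fun t => ENNReal.ofReal (max C 0 * (5 ^ blockIdx t)⁻¹)) (𝓝[<] 1) (𝓝 0) := by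
      have h1 : Tendsto (fun n : ℕ => max C 0 * ((5 : ℝ) ^ n)⁻¹) atTop (𝓝 0) := by
        have := (tendsto_pow_atTop_nhds_zero_of_lt_one (by norm_num : (0 : ℝ) ≤ 5⁻¹)
          (by norm_num)).const_mul (max C 0)
        rw [mul_zero] at this
        exact this.congr fun n => by rw [inv_pow]
      have h2 := (ENNReal.tendsto_ofReal h1).comp tendsto_blockIdx
      rwa [ENNReal.ofReal_zero] at h2
    refine tendsto_of_tendsto_of_tendsto_of_le_of_le tendsto_const_nhds hlim (fun _ => bot_le) fun t => ?_
    exact (limProfile_slice hb hH t).2.2.2.trans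
      (ENNReal.ofReal_le_ofReal (mul_le_mul_of_nonneg_right (le_max_left _ _) (by positivity)))
  · refine (tendsto_const_nhds (x := (0 : ℂ))).congr fun t => ?_
    rw [Torus.mFourierCoeff_eq_integral_volume, neg_zero, UnitAddTorus.mFourier_zero]
    have h0 : ∫ x, limProfile ρ t x = 0 := (limProfile_slice hb hH t).1
    symm
    calc ∫ x, ((1 : C(UnitAddTorus d, ℂ)) x) • ((limProfile ρ t x : ℝ) : ℂ)
        = ∫ x, ((limProfile ρ t x : ℝ) : ℂ) := integral_congr_ae (ae_of_all _ fun x => by simp)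
      _ = ((∫ x, limProfile ρ t x : ℝ) : ℂ) := integral_complex_ofReal
      _ = 0 := by rw [h0]; simp

end Scalars

end Estimates

end Literature.Analysis.FluidPDE.Gluing

end
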